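import Summits.NavierStokesRegularity.NavierStokesRegularity.Theorems.HeredityAtOne.Negative.LazyEnvelopeSlice
import Summits.NavierStokesRegularity.NavierStokesRegularity.Theorems.HeredityAtOne.Negative.SliceHeredityCap

/-!
# The lazy envelope slice is a CAPPED SIGNED swirl-free slice: both negative-lane reductions of S⁺
# are discharged by the same object, and S⁺ is false VERBATIM

Cell `ns-blowup`, seat `ns-blowup-fc-prover-3` (g6); sequel of `LazyEnvelopeSlice.lean` (this seat, p484570)
and bridge to `SliceHeredityCap.lean` (refuter-ns-palasek-19249-disprove-1 g2, p483223). NEGATIVE-LANE support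
for the route item `PalasekTowerBreakdown.HeredityAtOne` (stmt-NavierStokesRegularity-19249). LABEL: kernel, no
named fact. WHAT THIS IS NOT: not NS evidence and not a refutation of the crux — the design-free STRENGTHENING
S⁺ (`SliceHeredityAtOne` of `Cruxes/HeredityAtOne/StrategyCensus.lean`) is what dies; the crux's register is
untouched (no registered stage is exhibited; under the crux the lazy slice is provably unregistered,
`palasekTowerBreakdown_heredityAtOne_lazySlice_unregistered`).

* `signedNoSwirlSlice_lazySlice : SignedNoSwirlSlice lazySlice lvl` (axisymmetric, swirl-free,
  `0 ≤ ω_θ/r ≤ M`, `ω_θ/r` and `r² ω_θ/r` integrable);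
* `capValue_lazySlice_lt` — the Gallay–Šverák cap VALUE of the slice,
  `0.35356 √(√((∫η)(∫r²η)) M) < 5702` (`< 6139 < Y₂`);
* `exists_capped_signed_envelope_slice` — the `∃`-binder of disprove-1's
  `not_sliceHeredityAtOne_of_capped_signed_envelope_slice` DISCHARGED (design `lazyDesign`, slice `lazySlice`,
  height `M = lvl`);
* **`not_sliceHeredityAtOne_body`** — the NEGATION OF THE BODY of `SliceHeredityAtOne`, verbatim
  (`¬ ∀ S pinned rigid quiet, ∀ v, (Letter S 1 v ∧ ‖v‖ ≤ c₂ Y₁) → SliceRun S 1 (Letter · 2) v`): in the crux file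
  `theorem not_sliceHeredityAtOne : ¬ SliceHeredityAtOne := not_sliceHeredityAtOne_body` typechecks by `Iff.rfl`.
  Two proofs: directly from `not_sliceRun_lazySlice_lazyDesign` + `envelope_lazySlice`, and through disprove-1's
  reduction (`not_sliceHeredityAtOne_body'`).

References: S. Palasek, arXiv:2605.13827 §4 [cite: Palasek2026ElementaryModel, §4]; Th. Gallay, V. Šverák,
Confluentes Math. 7 (2015) [cite: GallaySverak2016, Prop. 2.6 (2.14), Lemma 5.1, Lemma 6.4 (arXiv pp. 8, 16, 19)].
-/

noncomputable section

namespace Summit.NavierStokesRegularity.HeredityAtOneLazySlice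

open Set MeasureTheory Function Real
open scoped ENNReal ContDiff
open Literature.Analysis.FluidPDE
open Summit.NavierStokesRegularity.FluidComputer
open Summit.NavierStokesRegularity.FluidComputer.SmoothedHill
open Summit.NavierStokesRegularity.FluidComputer.PalasekTowerClayBridge
open Summit.NavierStokesRegularity.FluidComputer.PalasekTowerClayBridge.TowerRates
open Summit.NavierStokesRegularity.NavierStokesRegularity
open Summit.NavierStokesRegularity.HeredityAtOneNoSwirlCap
open Summit.NavierStokesRegularity.HeredityAtOneNoSwirlStratum

/-- **The lazy slice is a single-signed swirl-free slice of height `M = 3.92·10⁸`.**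
[cite: GallaySverak2016, Thm. 1.1] -/
theorem signedNoSwirlSlice_lazySlice : SignedNoSwirlSlice lazySlice lvl where
  axisym := isAxisymmetric_hillField _ _ _
  noSwirl := hasNoSwirl_hillField _ _ _
  nonneg := angVortQuot_hillField_nonneg lvl_nonneg rIn_pos rIn_lt_rOut
  le := angVortQuot_hillField_le lvl_nonneg rIn_pos rIn_lt_rOut
  integrable := integrable_angVortQuot_hillField rIn_pos rIn_lt_rOut
  integrable_sq := integrable_cylRadius_sq_mul_angVortQuot_hillField rIn_pos rIn_lt_rOut

/-- **The cap value of the lazy slice**: `0.35356 √(√((∫η)(∫r²η)) M) < 5702` (`∫η ≤ (4π/3)Mb³`,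
`∫r²η ≤ (4π/5)Mb⁵`, `π < 3.15`). [cite: GallaySverak2016, Prop. 2.6 (2.14), Lemma 5.1, Lemma 6.4 (arXiv pp. 8, 16, 19)] -/
theorem capValue_lazySlice_lt :
    0.35356 * Real.sqrt (Real.sqrt ((∫ y, angVortQuot lazySlice y) *
      ∫ y, cylRadius y ^ 2 * angVortQuot lazySlice y) * lvl) < 5702 := by
  set I₁ := ∫ y, angVortQuot lazySlice y with hI₁
  set I₂ := ∫ y, cylRadius y ^ 2 * angVortQuot lazySlice y with hI₂
  have hI₂0 : 0 ≤ I₂ := integral_nonneg fun y =>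
    mul_nonneg (sq_nonneg _) (angVortQuot_hillField_nonneg lvl_nonneg rIn_pos rIn_lt_rOut y)
  have hI₁le : I₁ ≤ 4 * π / 3 * lvl * rOut ^ 3 :=
    integral_angVortQuot_hillField_le lvl_nonneg rIn_pos rIn_lt_rOut
  have hI₂le : I₂ ≤ 4 * π / 5 * lvl * rOut ^ 5 :=
    integral_cylRadius_sq_mul_angVortQuot_hillField_le lvl_nonneg rIn_pos rIn_lt_rOut
  have hπ := Real.pi_lt_d2
  have hπ0 := Real.pi_pos
  have hprod : I₁ * I₂ ≤ 0.44 := by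
    have h1 : 4 * π / 3 * lvl * rOut ^ 3 ≤ 178 := by norm_num [lvl, rOut]; nlinarith
    have h2 : 4 * π / 5 * lvl * rOut ^ 5 ≤ 0.002419 := by norm_num [lvl, rOut]; nlinarith
    calc I₁ * I₂ ≤ 178 * 0.002419 := mul_le_mul (hI₁le.trans h1) (hI₂le.trans h2) hI₂0 (by norm_num)
      _ ≤ 0.44 := by norm_num
  have hs1 : Real.sqrt (I₁ * I₂) ≤ 0.6634 := by
    rw [Real.sqrt_le_iff]; exact ⟨by norm_num, hprod.trans (by norm_num)⟩
  have hs2 : Real.sqrt (I₁ * I₂) * lvl ≤ 0.6634 * 392000000 := by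
    unfold lvl; exact mul_le_mul_of_nonneg_right hs1 (by norm_num)
  have hs3 : Real.sqrt (Real.sqrt (I₁ * I₂) * lvl) ≤ 16127 := by
    rw [Real.sqrt_le_iff]; exact ⟨by norm_num, hs2.trans (by norm_num)⟩
  calc 0.35356 * Real.sqrt (Real.sqrt (I₁ * I₂) * lvl) ≤ 0.35356 * 16127 :=
        mul_le_mul_of_nonneg_left hs3 (by norm_num)
    _ < 5702 := by norm_num

/-- The cap value is below the level-2 floor of every wide schedule with `c₁ = 1`: `< c₁ Y₂`.
[cite: GallaySverak2016, Prop. 2.6 (2.14), Lemma 5.1, Lemma 6.4 (arXiv pp. 8, 16, 19)] -/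
theorem capValue_lazySlice_lt_floor (S : Schedule TowerRates.wide) (hc : S.c₁ = 1) :
    0.35356 * Real.sqrt (Real.sqrt ((∫ y, angVortQuot lazySlice y) *
      ∫ y, cylRadius y ^ 2 * angVortQuot lazySlice y) * lvl) < S.c₁ * TowerRates.wide.Y 2 := by
  rw [hc, one_mul]
  have hY2 := wide_Y_two_bounds
  linarith [capValue_lazySlice_lt, hY2.1]

/-- **disprove-1's kinematic remainder, DISCHARGED**: the `∃`-binder of
`not_sliceHeredityAtOne_of_capped_signed_envelope_slice` (p483223) holds with the lazy design, the lazy slice and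
`M = lvl`. [cite: Palasek2026ElementaryModel, §4] -/
theorem exists_capped_signed_envelope_slice :
    ∃ (S : Schedule TowerRates.wide) (v : EuclideanSpace ℝ (Fin 3) → EuclideanSpace ℝ (Fin 3)) (M : ℝ),
      S.Pins 8 (6 / 5) ∧ S.Rigid ∧ S.Quiet ∧ S.c₁ ≤ S.c₂ ∧
      (Letter S 1 v ∧ ∀ x, ‖v x‖ ≤ S.c₂ * TowerRates.wide.Y 1) ∧
      ContDiff ℝ ∞ v ∧ VectorCalculus.IsDivFree v ∧ (∀ n : ℕ, ∫⁻ x, ‖iteratedFDeriv ℝ n v x‖ₑ ^ 2 < ⊤) ∧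
      SignedNoSwirlSlice v M ∧
      0.35356 * Real.sqrt (Real.sqrt ((∫ y, angVortQuot v y) *
        ∫ y, cylRadius y ^ 2 * angVortQuot v y) * M) < S.c₁ * TowerRates.wide.Y 2 :=
  have h := lazySlice_regular
  ⟨lazyDesign, lazySlice, lvl, lazyDesign_pins, lazyDesign_rigid, lazyDesign_quiet,
    by rw [lazyDesign_c₁, lazyDesign_rigid.c₂_eq]; norm_num, envelope_lazySlice, h.1, h.2.1, h.2.2.1,
    signedNoSwirlSlice_lazySlice, capValue_lazySlice_lt_floor lazyDesign rfl⟩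

/-- **S⁺ IS FALSE — the body of `SliceHeredityAtOne` negated, verbatim** (so that in
`Cruxes/HeredityAtOne/StrategyCensus.lean` the census decl is refuted by `Iff.rfl`): it is NOT the case that for
every pinned rigid quiet wide design and every slice carrying the level-1 letter and the level-1 ceiling, every
unforced finite-energy classical run of length `τ₂ − τ₁` from it inside the ceiling `c₂ Y₂` ends with the level-2
letter. Witness: the lazy design and the lazy slice. [cite: Palasek2026ElementaryModel, §4] -/
theorem not_sliceHeredityAtOne_body :
    ¬ ∀ S : Schedule TowerRates.wide, S.Pins 8 (6 / 5) → S.Rigid → S.Quiet →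
        ∀ v : EuclideanSpace ℝ (Fin 3) → EuclideanSpace ℝ (Fin 3),
          (Letter S 1 v ∧ ∀ x, ‖v x‖ ≤ S.c₂ * TowerRates.wide.Y 1) →
            SliceRun S 1 (fun S w => Letter S 2 w) v :=
  fun h => not_sliceRun_lazySlice_lazyDesign
    (h lazyDesign lazyDesign_pins lazyDesign_rigid lazyDesign_quiet lazySlice envelope_lazySlice)

/-- The same negation through disprove-1's reduction (the two negative-lane lines agree).
[cite: Palasek2026ElementaryModel, §4] -/
theorem not_sliceHeredityAtOne_body' :
    ¬ ∀ S : Schedule TowerRates.wide, S.Pins 8 (6 / 5) → S.Rigid → S.Quiet →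
        ∀ v : EuclideanSpace ℝ (Fin 3) → EuclideanSpace ℝ (Fin 3),
          (Letter S 1 v ∧ ∀ x, ‖v x‖ ≤ S.c₂ * TowerRates.wide.Y 1) →
            SliceRun S 1 (fun S w => Letter S 2 w) v :=
  not_sliceHeredityAtOne_of_capped_signed_envelope_slice exists_capped_signed_envelope_slice

end Summit.NavierStokesRegularity.HeredityAtOneLazySlice

end
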